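import Mathlib
import Summits.Ventures.PercRepro2.CoinOrTailAlg
import Summits.Ventures.PercRepro2.CoinOrTailKDefs
import Summits.Ventures.PercRepro2.CoinOrTailKSums
import Summits.Ventures.PercRepro2.CoinOrTailKAlg
import Summits.Ventures.PercRepro2.CoinK2HeadBlindVals
import Summits.Ventures.PercRepro2.CoinK2HeadAwareCore

/-!
# The coin splitting — the algebra: two uncovered entries with ARBITRARY coin probabilities
reduce to the sure case (blind cell PercRepro2, night-2 g13; proofs/NIGHT2-DARC.md §48.7)

The entry coin `r → a` of probability `ρ` is a SURE arc `r' → a` from a virtual vertex `r'`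
joined from `r` with probability `ρ`: on the extended lattice `U' = U ∪ {r₁', r₂'}` the weight
`ν'(W') = ν(W' ∩ U) · g₁(W') · g₂(W')` with the coin factor
`g(W') = if r' ∈ W' then (if r ∈ W' then ρ else 0) else (if r ∈ W' then 1 − ρ else 1)` is
log-supermodular (`coinFactor_mul_le`), the head `A'(X) = A (X ∩ V₀)` is nonnegative, decreasing
and log-supermodular, and summing out the virtual coordinates (`Finset.sum_powerset_insert` twice)
returns the original `R`-weight and gate weight (`ext_sum_rValK`, `ext_sum_gValK`).  The
functional theorem and the DARC theorem for arbitrary coins are in `CoinK2HeadAwareCoins`.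
-/

namespace Summit.Ventures.PercRepro2.Coin

open Classical

section CoinSplit

variable {V : Type*} {E : Type*} [Fintype V] [DecidableEq V] {R : Type*} [Field R] [LinearOrder R]
  [IsStrictOrderedRing R]

omit [Fintype V] in
/-- The coin factor of one entry is nonnegative. -/
lemma coinFactor_nonneg (r r' : V) {ρ : R} (h0 : 0 ≤ ρ) (h1 : ρ ≤ 1) (W : Finset V) :
    0 ≤ (if r' ∈ W then (if r ∈ W then ρ else 0) else (if r ∈ W then 1 - ρ else 1)) := by
  split_ifs <;> linarith

omit [Fintype V] in
/-- The coin factor is log-supermodular (log-modular on its sublattice support). -/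
lemma coinFactor_mul_le (r r' : V) {ρ : R} (h0 : 0 ≤ ρ) (s t : Finset V) :
    (if r' ∈ s then (if r ∈ s then ρ else 0) else (if r ∈ s then 1 - ρ else 1)) *
      (if r' ∈ t then (if r ∈ t then ρ else 0) else (if r ∈ t then 1 - ρ else 1)) ≤
    (if r' ∈ s ∩ t then (if r ∈ s ∩ t then ρ else 0) else (if r ∈ s ∩ t then 1 - ρ else 1)) *
      (if r' ∈ s ∪ t then (if r ∈ s ∪ t then ρ else 0) else (if r ∈ s ∪ t then 1 - ρ else 1)) := by
  by_cases hs : r ∈ s <;> by_cases hs' : r' ∈ s <;> by_cases ht : r ∈ t <;> by_cases ht' : r' ∈ t <;>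
    simp [hs, hs', ht, ht', Finset.mem_inter, Finset.mem_union] <;> nlinarith

omit [Fintype V] [LinearOrder R] [IsStrictOrderedRing R] in
/-- The coin factor with the virtual vertex absent / present: `c + o = 1`, `c = 1 − ρ·[r ∈ W]`. -/
lemma coinFactor_split (r r' : V) (ρ : R) {W : Finset V} (hr' : r' ∉ W) (hne : r ≠ r') :
    (if r' ∈ W then (if r ∈ W then ρ else 0) else (if r ∈ W then 1 - ρ else 1))
        = 1 - ρ * (if r ∈ W then 1 else 0) ∧
    (if r' ∈ insert r' W then (if r ∈ insert r' W then ρ else 0)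
        else (if r ∈ insert r' W then 1 - ρ else 1)) = ρ * (if r ∈ W then 1 else 0) := by
  have h1 : r' ∈ insert r' W := Finset.mem_insert_self _ _
  have h2 : r ∈ insert r' W ↔ r ∈ W := by simp [Finset.mem_insert, hne]
  by_cases hr : r ∈ W <;> simp [hr', hr, h1, h2]

omit [Fintype V] [LinearOrder R] [IsStrictOrderedRing R] in
/-- The coin factor does not see a vertex other than `r, r'`. -/
lemma coinFactor_insert_other (r r' x : V) (ρ : R) (W : Finset V) (hxr : r ≠ x) (hxr' : r' ≠ x) :
    (if r' ∈ insert x W then (if r ∈ insert x W then ρ else 0)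
        else (if r ∈ insert x W then 1 - ρ else 1)) =
      (if r' ∈ W then (if r ∈ W then ρ else 0) else (if r ∈ W then 1 - ρ else 1)) := by
  have h1 : r' ∈ insert x W ↔ r' ∈ W := by simp [Finset.mem_insert, hxr']
  have h2 : r ∈ insert x W ↔ r ∈ W := by simp [Finset.mem_insert, hxr]
  simp only [h1, h2]

omit [Fintype V] [Field R] [LinearOrder R] [IsStrictOrderedRing R] in
/-- The extended head value of a virtual-free set: the original head value. -/
lemma ext_head_of_subset (A : Finset V → R) (V₀ S : Finset V) (hS : S ⊆ V₀) :
    A (S ∩ V₀) = A S := by rw [Finset.inter_eq_left.2 hS]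

omit [Fintype V] [Field R] [LinearOrder R] [IsStrictOrderedRing R] in
/-- The extended head value after inserting a virtual vertex. -/
lemma ext_head_insert (A : Finset V → R) (V₀ S : Finset V) (x : V) (hx : x ∉ V₀) (hS : S ⊆ V₀) :
    A (insert x S ∩ V₀) = A S := by
  rw [Finset.insert_inter_of_notMem hx, Finset.inter_eq_left.2 hS]

omit [Fintype V] [Field R] [LinearOrder R] [IsStrictOrderedRing R] in
/-- The extended head value after inserting two virtual vertices. -/
lemma ext_head_insert₂ (A : Finset V → R) (V₀ S : Finset V) (x y : V) (hx : x ∉ V₀) (hy : y ∉ V₀)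
    (hS : S ⊆ V₀) : A (insert y (insert x S) ∩ V₀) = A S := by
  rw [Finset.insert_inter_of_notMem hy, Finset.insert_inter_of_notMem hx, Finset.inter_eq_left.2 hS]

omit [Fintype V] [LinearOrder R] [IsStrictOrderedRing R] in
/-- **Summing out the two virtual coordinates** (the `R`-weight): for the entry set `{r₁, r₂} ⊆ U`
and virtual vertices `r₁', r₂' ∉ U ∪ {a, w}`, the extended sure-coin `R`-weight returns the
original one. -/
theorem ext_sum_rValK (U : Finset V) (ν A : Finset V → R) (pr : E → R) (c : V → E)
    (r₁ r₂ r₁' r₂' a w : V)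
    (hr₁U : r₁ ∈ U) (hr₂U : r₂ ∈ U) (hr₁₂ : r₁ ≠ r₂)
    (hr₁' : r₁' ∉ U) (hr₂' : r₂' ∉ U) (hr' : r₁' ≠ r₂') (hr₁'a : r₁' ≠ a) (hr₁'w : r₁' ≠ w)
    (hr₂'a : r₂' ≠ a) (hr₂'w : r₂' ≠ w) (J : Finset V → R)
    (hJ : ∀ W ⊆ U, J (insert r₁' W) = J W ∧ J (insert r₂' W) = J W ∧
      J (insert r₂' (insert r₁' W)) = J W) :
    (∑ W' ∈ (insert r₂' (insert r₁' U)).powerset,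
        (ν (W' ∩ U) *
          ((if r₁' ∈ W' then (if r₁ ∈ W' then pr (c r₁) else 0)
            else (if r₁ ∈ W' then 1 - pr (c r₁) else 1)) *
          (if r₂' ∈ W' then (if r₂ ∈ W' then pr (c r₂) else 0)
            else (if r₂ ∈ W' then 1 - pr (c r₂) else 1)))) *
        rValK (fun Y => A (Y ∩ (U ∪ {a, w}))) (fun _ => (1 : R)) {r₁', r₂'} c a W' * J W') =
      ∑ W ∈ U.powerset, ν W * rValK A pr {r₁, r₂} c a W * J W := by
  have hr₂'U' : r₂' ∉ insert r₁' U := by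
    simp only [Finset.mem_insert, not_or]; exact ⟨hr'.symm, hr₂'⟩
  have hsure' : ∀ r ∈ ({r₁', r₂'} : Finset V), (fun _ : E => (1 : R)) (c r) = 1 := fun _ _ => rfl
  have hr₁'V : r₁' ∉ U ∪ {a, w} := by
    simp only [Finset.mem_union, Finset.mem_insert, Finset.mem_singleton, not_or]
    exact ⟨hr₁', hr₁'a, hr₁'w⟩
  have hr₂'V : r₂' ∉ U ∪ {a, w} := by
    simp only [Finset.mem_union, Finset.mem_insert, Finset.mem_singleton, not_or]
    exact ⟨hr₂', hr₂'a, hr₂'w⟩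
  rw [Finset.sum_powerset_insert hr₂'U', Finset.sum_powerset_insert hr₁',
    Finset.sum_powerset_insert hr₁', ← Finset.sum_add_distrib, ← Finset.sum_add_distrib,
    ← Finset.sum_add_distrib]
  refine Finset.sum_congr rfl fun W hW => ?_
  rw [Finset.mem_powerset] at hW
  have hWV : W ⊆ U ∪ {a, w} := hW.trans Finset.subset_union_left
  have hWaV : W ∪ {a} ⊆ U ∪ {a, w} := by
    intro x hx
    rw [Finset.mem_union, Finset.mem_singleton] at hx
    rw [Finset.mem_union, Finset.mem_insert, Finset.mem_singleton]
    rcases hx with hx | rfl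
    · exact Or.inl (hW hx)
    · exact Or.inr (Or.inl rfl)
  have h1W : r₁' ∉ W := fun h => hr₁' (hW h)
  have h2W : r₂' ∉ W := fun h => hr₂' (hW h)
  have h2W' : r₂' ∉ insert r₁' W := by
    simp only [Finset.mem_insert, not_or]; exact ⟨hr'.symm, h2W⟩
  have hne₁ : r₁ ≠ r₁' := fun h => hr₁' (h ▸ hr₁U)
  have hne₂ : r₂ ≠ r₂' := fun h => hr₂' (h ▸ hr₂U)
  have hne₁₂ : r₁ ≠ r₂' := fun h => hr₂' (h ▸ hr₁U)
  have hne₂₁ : r₂ ≠ r₁' := fun h => hr₁' (h ▸ hr₂U)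
  -- the intersections with `U`
  have i0 : W ∩ U = W := Finset.inter_eq_left.2 hW
  have i1 : insert r₁' W ∩ U = W := by rw [Finset.insert_inter_of_notMem hr₁', i0]
  have i2 : insert r₂' W ∩ U = W := by rw [Finset.insert_inter_of_notMem hr₂', i0]
  have i12 : insert r₂' (insert r₁' W) ∩ U = W := by
    rw [Finset.insert_inter_of_notMem hr₂', i1]
  -- the coin factors
  obtain ⟨c1, o1⟩ := coinFactor_split r₁ r₁' (pr (c r₁)) h1W hne₁
  obtain ⟨c2, o2⟩ := coinFactor_split r₂ r₂' (pr (c r₂)) h2W hne₂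
  have f2at1 := coinFactor_insert_other r₂ r₂' r₁' (pr (c r₂)) W hne₂₁ hr'.symm
  have f1at2 := coinFactor_insert_other r₁ r₁' r₂' (pr (c r₁)) W hne₁₂ hr'
  have f1at12 := coinFactor_insert_other r₁ r₁' r₂' (pr (c r₁)) (insert r₁' W) hne₁₂ hr'
  have f2at12 : (if r₂' ∈ insert r₂' (insert r₁' W) then
      (if r₂ ∈ insert r₂' (insert r₁' W) then pr (c r₂) else 0)
      else (if r₂ ∈ insert r₂' (insert r₁' W) then 1 - pr (c r₂) else 1)) =
      pr (c r₂) * (if r₂ ∈ W then 1 else 0) := by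
    have e := (coinFactor_split r₂ r₂' (pr (c r₂)) h2W' hne₂).2
    rw [e]
    have : r₂ ∈ insert r₁' W ↔ r₂ ∈ W := by simp [Finset.mem_insert, hne₂₁]
    simp only [this]
  -- the head values with sure coins
  have v0 : rValK (fun Y => A (Y ∩ (U ∪ {a, w}))) (fun _ : E => (1 : R)) {r₁', r₂'} c a W = A W := by
    rw [rValK_of_no_entry _ _ c a (fun r hr hrW => ?_)]
    · exact ext_head_of_subset A _ W hWV
    · rw [Finset.mem_insert, Finset.mem_singleton] at hr
      rcases hr with rfl | rfl
      · exact h1W hrW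
      · exact h2W hrW
  have v1 : rValK (fun Y => A (Y ∩ (U ∪ {a, w}))) (fun _ : E => (1 : R)) {r₁', r₂'} c a
      (insert r₁' W) = A (W ∪ {a}) := by
    rw [rValK_sure_of_entry _ _ c a hsure' ⟨r₁', Finset.mem_insert_self _ _, Finset.mem_insert_self _ _⟩,
      Finset.insert_union]
    exact ext_head_insert A _ _ r₁' hr₁'V hWaV
  have v2 : rValK (fun Y => A (Y ∩ (U ∪ {a, w}))) (fun _ : E => (1 : R)) {r₁', r₂'} c a
      (insert r₂' W) = A (W ∪ {a}) := by
    rw [rValK_sure_of_entry _ _ c a hsure' ⟨r₂', by simp, Finset.mem_insert_self _ _⟩,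
      Finset.insert_union]
    exact ext_head_insert A _ _ r₂' hr₂'V hWaV
  have v12 : rValK (fun Y => A (Y ∩ (U ∪ {a, w}))) (fun _ : E => (1 : R)) {r₁', r₂'} c a
      (insert r₂' (insert r₁' W)) = A (W ∪ {a}) := by
    rw [rValK_sure_of_entry _ _ c a hsure' ⟨r₂', by simp, Finset.mem_insert_self _ _⟩,
      Finset.insert_union, Finset.insert_union]
    exact ext_head_insert₂ A _ _ r₁' r₂' hr₁'V hr₂'V hWaV
  -- the original value
  have vo : rValK A pr {r₁, r₂} c a W =
      (1 - pr (c r₁) * (if r₁ ∈ W then 1 else 0)) * (1 - pr (c r₂) * (if r₂ ∈ W then 1 else 0)) * A W +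
      (1 - (1 - pr (c r₁) * (if r₁ ∈ W then 1 else 0)) *
        (1 - pr (c r₂) * (if r₂ ∈ W then 1 else 0))) * A (W ∪ {a}) := by
    unfold rValK tailWtK
    rw [Finset.prod_pair hr₁₂]
  obtain ⟨j1, j2, j12⟩ := hJ W hW
  rw [i0, i1, i2, i12, f2at1, f1at2, f1at12, f2at12, c1, o1, c2, o2, v0, v1, v2, v12, vo, j1, j2,
    j12]
  ring

omit [Fintype V] [LinearOrder R] [IsStrictOrderedRing R] in
/-- **Summing out the two virtual coordinates** (the gate weight): for the entry set `{r₁, r₂} ⊆ U`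
and virtual vertices `r₁', r₂' ∉ U ∪ {a, w}`, the extended sure-coin gate weight returns the
original one. -/
theorem ext_sum_gValK (U : Finset V) (ν A : Finset V → R) (pr : E → R) (c : V → E)
    (r₁ r₂ r₁' r₂' a w : V)
    (hr₁U : r₁ ∈ U) (hr₂U : r₂ ∈ U) (hr₁₂ : r₁ ≠ r₂)
    (hr₁' : r₁' ∉ U) (hr₂' : r₂' ∉ U) (hr' : r₁' ≠ r₂') (hr₁'a : r₁' ≠ a) (hr₁'w : r₁' ≠ w)
    (hr₂'a : r₂' ≠ a) (hr₂'w : r₂' ≠ w) (J : Finset V → R)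
    (hJ : ∀ W ⊆ U, J (insert r₁' W) = J W ∧ J (insert r₂' W) = J W ∧
      J (insert r₂' (insert r₁' W)) = J W) :
    (∑ W' ∈ (insert r₂' (insert r₁' U)).powerset,
        (ν (W' ∩ U) *
          ((if r₁' ∈ W' then (if r₁ ∈ W' then pr (c r₁) else 0)
            else (if r₁ ∈ W' then 1 - pr (c r₁) else 1)) *
          (if r₂' ∈ W' then (if r₂ ∈ W' then pr (c r₂) else 0)
            else (if r₂ ∈ W' then 1 - pr (c r₂) else 1)))) *
        gValK (fun Y => A (Y ∩ (U ∪ {a, w}))) (fun _ => (1 : R)) {r₁', r₂'} c a w W' * J W') =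
      ∑ W ∈ U.powerset, ν W * gValK A pr {r₁, r₂} c a w W * J W := by
  have hr₂'U' : r₂' ∉ insert r₁' U := by
    simp only [Finset.mem_insert, not_or]; exact ⟨hr'.symm, hr₂'⟩
  have hsure' : ∀ r ∈ ({r₁', r₂'} : Finset V), (fun _ : E => (1 : R)) (c r) = 1 := fun _ _ => rfl
  have hr₁'V : r₁' ∉ U ∪ {a, w} := by
    simp only [Finset.mem_union, Finset.mem_insert, Finset.mem_singleton, not_or]
    exact ⟨hr₁', hr₁'a, hr₁'w⟩
  have hr₂'V : r₂' ∉ U ∪ {a, w} := by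
    simp only [Finset.mem_union, Finset.mem_insert, Finset.mem_singleton, not_or]
    exact ⟨hr₂', hr₂'a, hr₂'w⟩
  rw [Finset.sum_powerset_insert hr₂'U', Finset.sum_powerset_insert hr₁',
    Finset.sum_powerset_insert hr₁', ← Finset.sum_add_distrib, ← Finset.sum_add_distrib,
    ← Finset.sum_add_distrib]
  refine Finset.sum_congr rfl fun W hW => ?_
  rw [Finset.mem_powerset] at hW
  have hWV : W ⊆ U ∪ {a, w} := hW.trans Finset.subset_union_left
  have hWaV : W ∪ {a, w} ⊆ U ∪ {a, w} := Finset.union_subset_union_left hW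
  have h1W : r₁' ∉ W := fun h => hr₁' (hW h)
  have h2W : r₂' ∉ W := fun h => hr₂' (hW h)
  have h2W' : r₂' ∉ insert r₁' W := by
    simp only [Finset.mem_insert, not_or]; exact ⟨hr'.symm, h2W⟩
  have hne₁ : r₁ ≠ r₁' := fun h => hr₁' (h ▸ hr₁U)
  have hne₂ : r₂ ≠ r₂' := fun h => hr₂' (h ▸ hr₂U)
  have hne₁₂ : r₁ ≠ r₂' := fun h => hr₂' (h ▸ hr₁U)
  have hne₂₁ : r₂ ≠ r₁' := fun h => hr₁' (h ▸ hr₂U)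
  -- the intersections with `U`
  have i0 : W ∩ U = W := Finset.inter_eq_left.2 hW
  have i1 : insert r₁' W ∩ U = W := by rw [Finset.insert_inter_of_notMem hr₁', i0]
  have i2 : insert r₂' W ∩ U = W := by rw [Finset.insert_inter_of_notMem hr₂', i0]
  have i12 : insert r₂' (insert r₁' W) ∩ U = W := by
    rw [Finset.insert_inter_of_notMem hr₂', i1]
  -- the coin factors
  obtain ⟨c1, o1⟩ := coinFactor_split r₁ r₁' (pr (c r₁)) h1W hne₁
  obtain ⟨c2, o2⟩ := coinFactor_split r₂ r₂' (pr (c r₂)) h2W hne₂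
  have f2at1 := coinFactor_insert_other r₂ r₂' r₁' (pr (c r₂)) W hne₂₁ hr'.symm
  have f1at2 := coinFactor_insert_other r₁ r₁' r₂' (pr (c r₁)) W hne₁₂ hr'
  have f1at12 := coinFactor_insert_other r₁ r₁' r₂' (pr (c r₁)) (insert r₁' W) hne₁₂ hr'
  have f2at12 : (if r₂' ∈ insert r₂' (insert r₁' W) then
      (if r₂ ∈ insert r₂' (insert r₁' W) then pr (c r₂) else 0)
      else (if r₂ ∈ insert r₂' (insert r₁' W) then 1 - pr (c r₂) else 1)) =
      pr (c r₂) * (if r₂ ∈ W then 1 else 0) := by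
    have e := (coinFactor_split r₂ r₂' (pr (c r₂)) h2W' hne₂).2
    rw [e]
    have : r₂ ∈ insert r₁' W ↔ r₂ ∈ W := by simp [Finset.mem_insert, hne₂₁]
    simp only [this]
  -- the head values with sure coins
  have v0 : gValK (fun Y => A (Y ∩ (U ∪ {a, w}))) (fun _ : E => (1 : R)) {r₁', r₂'} c a w W = A W := by
    rw [gValK_eq_rValK_of_no_entry _ _ c a w (fun r hr hrW => ?_), rValK_of_no_entry _ _ c a (fun r hr hrW => ?_)]
    · exact ext_head_of_subset A _ W hWV
    · rw [Finset.mem_insert, Finset.mem_singleton] at hr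
      rcases hr with rfl | rfl
      · exact h1W hrW
      · exact h2W hrW
    · rw [Finset.mem_insert, Finset.mem_singleton] at hr
      rcases hr with rfl | rfl
      · exact h1W hrW
      · exact h2W hrW
  have v1 : gValK (fun Y => A (Y ∩ (U ∪ {a, w}))) (fun _ : E => (1 : R)) {r₁', r₂'} c a w
      (insert r₁' W) = A (W ∪ {a, w}) := by
    rw [gValK_sure_of_entry _ _ c a w hsure' ⟨r₁', Finset.mem_insert_self _ _, Finset.mem_insert_self _ _⟩,
      Finset.insert_union]
    exact ext_head_insert A _ _ r₁' hr₁'V hWaV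
  have v2 : gValK (fun Y => A (Y ∩ (U ∪ {a, w}))) (fun _ : E => (1 : R)) {r₁', r₂'} c a w
      (insert r₂' W) = A (W ∪ {a, w}) := by
    rw [gValK_sure_of_entry _ _ c a w hsure' ⟨r₂', by simp, Finset.mem_insert_self _ _⟩,
      Finset.insert_union]
    exact ext_head_insert A _ _ r₂' hr₂'V hWaV
  have v12 : gValK (fun Y => A (Y ∩ (U ∪ {a, w}))) (fun _ : E => (1 : R)) {r₁', r₂'} c a w
      (insert r₂' (insert r₁' W)) = A (W ∪ {a, w}) := by
    rw [gValK_sure_of_entry _ _ c a w hsure' ⟨r₂', by simp, Finset.mem_insert_self _ _⟩,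
      Finset.insert_union, Finset.insert_union]
    exact ext_head_insert₂ A _ _ r₁' r₂' hr₁'V hr₂'V hWaV
  -- the original value
  have vo : gValK A pr {r₁, r₂} c a w W =
      (1 - pr (c r₁) * (if r₁ ∈ W then 1 else 0)) * (1 - pr (c r₂) * (if r₂ ∈ W then 1 else 0)) * A W +
      (1 - (1 - pr (c r₁) * (if r₁ ∈ W then 1 else 0)) *
        (1 - pr (c r₂) * (if r₂ ∈ W then 1 else 0))) * A (W ∪ {a, w}) := by
    unfold gValK tailWtK
    rw [Finset.prod_pair hr₁₂]
  obtain ⟨j1, j2, j12⟩ := hJ W hW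
  rw [i0, i1, i2, i12, f2at1, f1at2, f1at12, f2at12, c1, o1, c2, o2, v0, v1, v2, v12, vo, j1, j2,
    j12]
  ring

end CoinSplit

end Summit.Ventures.PercRepro2.Coin
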